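import Summits.ABC.ABC.Theorems.IsogenyGlueCongruenceMazurKenkuBoundStubMiddleSeven
import Summits.ABC.ABC.Theorems.IsogenyGlueCongruenceMazurKenkuBoundStubHauptmodulSeven
import Summits.ABC.ABC.Theorems.IsogenyGlueCongruenceMazurKenkuBoundStubKubertSevenRigidity
import Summits.ABC.ABC.Theorems.IsogenyGlueCongruenceMazurKenkuBoundStubLevel49Endgame
import Summits.ABC.ABC.Theorems.IsogenyGlueCongruenceMazurKenkuBoundStubLevelFortyNineGlue
import Summits.ABC.ABC.Theses.IsogenyGlueCongruence
import HarnessLib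

/-!
# Route `IsogenyGlueCongruence`, child `KenkuLevelFortyNine` (stmt-ABC-18226) of the split crux
# `MazurKenkuBound` — PROVED: no elliptic curve over `ℚ` has a rational cyclic `49`-isogeny

Kenku's level `49` (`X₀(49) ≅ X_sp(7) ≅ 49a1` has only its two rational cusps; Ligozat 1975, Kenku
1982 p. 200), here with a modular-curve-free proof assembled from the five landed files of the
level-`49` line of crux `MazurKenkuBound` (lead c23, cycle 25):

* `stub_middleSeven` (p172906): the quotient `V₁ = V/⟨7P⟩` of a cyclic `49`-isogeny with kernel `ℤP`
  (tree: `exists_isogeny_ker_eq_and_comp_eq_nsmul_holds`) carries two DISTINCT `Γ_ℚ`-stable cyclic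
  subgroups of order `7`;
* `stub_hauptmodulSeven` (p173295, over `Literature/…/KleinFrickeLevelSevenTorsion.lean`, p173215):
  Klein–Fricke at `7` from a torsion point through Kubert's Tate normal form `E(b, c)`,
  `b = d³ - d²`, `c = d² - d`, WITH the value `η = (d³ - 8d² + 5d + 1)/(d(d - 1)) ∈ ℚ` of the
  Hauptmodul, `j η = (η² + 13η + 49)(η² + 5η + 1)³`;
* `stub_kubertSevenRigidity` (p173095): equal Hauptmodul values force the two base points into
  one cyclic subgroup (deck orbit `d ↦ 1/(1 - d)` of `X₁(7) → X₀(7)` + rigidity of Weierstrass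
  equations with `c₄c₆ ≠ 0`);
* `stub_level49Endgame` (p173772, over `Literature/…/XZeroFortyNineExplicit.lean`, p173309 — the
  explicit isomorphism `X₀(49) ≅ 49a1`, certified by polynomial identities — and
  `Literature/…/Curve49A1Points.lean`, p173080 — `49a1(ℚ) = {O, (2, -1)}` by `2`-isogeny descent):
  two distinct nonzero rationals never share a value of `R₇(h) = P(h)/h`;
* `stub_levelFortyNineGlue` (p174127): the composition.
[cite: Kenku1982, proof of Thm. 1, p. 200] [cite: Ligozat1975]
[cite: CremonaAlgorithms1997, Table 1 (49a1)]
-/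

set_option linter.dupNamespace false

noncomputable section

open scoped Classical

open WeierstrassCurve
open Literature.NumberTheory.EllipticCurves

namespace Summit.ABC.ABC.Theorems

/-- **Kenku's level `49`, proved**: no elliptic curve over `ℚ` admits a `ℚ`-rational isogeny with
cyclic kernel of order `49` — child `KenkuLevelFortyNine` (stmt-ABC-18226) of the split crux
`MazurKenkuBound`, from the five landed files of the level-`49` line. [cite: Kenku1982, proof of
Thm. 1, p. 200] [cite: Ligozat1975] -/
theorem kenkuLevelFortyNine_proof :
    Summit.ABC.ABC.Theses.IsogenyGlueCongruence.KenkuLevelFortyNine :=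
  stub_levelFortyNineGlue stub_middleSeven stub_hauptmodulSeven stub_kubertSevenRigidity
    stub_level49Endgame

/-- **No rational cyclic `49`-isogeny** (the same statement, under a citable name).
[cite: Kenku1982, proof of Thm. 1, p. 200] [cite: Ligozat1975] -/
theorem isogeny_isCyclic_degree_ne_fortyNine {V V' : WeierstrassCurve ℚ} [V.IsElliptic]
    [V'.IsElliptic] (ψ : Isogeny V V') (hψ : ψ.IsCyclic) : ψ.degree ≠ 49 :=
  kenkuLevelFortyNine_proof V V' ψ hψ

end Summit.ABC.ABC.Theorems

end
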